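import Literature.Probability.LatticeModels.DobrushinComparisonBoundary
import Summits.Ventures.YMGap.Thresholds.QuarterModulusOneHalf
import Summits.Ventures.YMGap.Thresholds.StarWindow
import HarnessLib

/-!
# Venture YMGap — track (c) «DS»: window contraction of an `SU(2)` Wilson torus kernel from the
# single-link quarter modulus and a super-solution (brick B3″ of the cell's K-row plan)

HONEST FRAMING: venture file (cell `pub-ymgap`), strong-coupling LATTICE bookkeeping only. It
specialises the tree's two-boundary-condition comparison
`DobrushinMetric.abs_kernel_sub_le_of_superSolution` (Dobrushin 1970 Thm. 3 / Föllmer 1988 Ch. I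
(2.8) with (2.10), `DobrushinComparisonBoundary.lean`) to the torus weight specification of the
`SU(2)` Wilson action at Wilson coupling `0 ≤ β_W ≤ 1/2` (tree coupling `β_W/2`), whose single-link
Dobrushin coefficients in the Vasserstein (Frobenius) form are `c · n(x, z)`, `c = β_W/4`,
`n = tInfluence` (joint-plaquette multiplicity), by the kernel quarter modulus
(`QuarterModulusOneHalf.oneLinkKRModulusSU2_of_le_oneHalf` + `isKRContraction_torusWilson`):

* `su2Kernel_window_contraction` — for any finite link set `Λ` of the torus `(ℤ/L)^4` (`L ≥ 2`),
  an exterior link `y ∉ Λ`, two configurations `ω = η` off `y`, any `d ≥ 0` with `d_y ≥ 1` and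
  `Σ_{z ∈ nbr x} c·n(x,z)·d_z ≤ d_x` for `x ∈ Λ` (a super-solution of the `Λ`-restricted resolvent
  equation; e.g. the explicit columns of `StarGaugeReceivedSum` for the gauge-fixed vertex star),
  and `Λ`-restricted row sums `≤ c' < 1`: every bounded measurable `f` depending on `Δ` with
  per-link Frobenius-Lipschitz vector `δ` satisfies
  `|∫ f dγ_Λ(·|ω) − ∫ f dγ_Λ(·|η)| ≤ ‖ω_y − η_y‖_F · Σ_{z ∈ Δ} d_z δ_z`.

This is the analytic half of hypothesis (H1) of `DSWindow.StarWindowBound` for the gauge-fixed star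
(`Λ = vertexStar s ∖ {a}` with `x_a` frozen): what remains for the K-row «SC-a for `SU(2)`, `d = 4`
at `β_W ≤ 1/3`» (cell PLAN R94/R96, HOME/ds/LEAN-KROW.md) is the gauge reduction
(`StarGaugeInvariance`, `StarKernel`, `StarDisintegration`) and the assembly with the resolvent
columns (`StarGaugeReceivedSum`). Nothing is asserted here about those; no continuum / mass-gap claim.
-/

noncomputable section

open MeasureTheory ProbabilityTheory Function Finset
open Literature.Probability.LatticeModels
open Literature.Probability.LatticeModels.DobrushinMetric
open Literature.MathematicalPhysics.QuantumFieldTheory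
open Literature.MathematicalPhysics.QuantumFieldTheory.Balaban1983to89.StrongCouplingDobrushinWindow
  (OneLinkKRModulus OneLinkKRModulusSU2)
open Literature.MathematicalPhysics.QuantumFieldTheory.Balaban1983to89.StrongCouplingTorusWindow
  (wilsonPlaqWeight continuous_wilsonPlaqWeight wilsonPlaqWeight_pos tInfluence
  isKRContraction_torusWilson)

namespace Summit.Ventures.YMGap.DSWindow

variable {L : ℕ} [NeZero L]

/-- **Dobrushin's coefficients of the `SU(2)` Wilson torus specification are `c · n(x, z)`**,
`c = β_W/4`, for `0 ≤ β_W ≤ 1/2` (Frobenius weight; the kernel quarter modulus on the ball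
`‖B‖_op ≤ 3β_W/2 ≤ 3/4`, `QuarterModulusOneHalf`, fed into `isKRContraction_torusWilson`). -/
theorem su2_isKRContraction_torusWilson (hL : 1 < L) {βW : ℝ} (h0 : 0 ≤ βW) (h12 : βW ≤ 1 / 2) :
    IsKRContraction (torusWeightSpec (d := 4) (L := L) (wilsonPlaqWeight 2 (βW / 2))) suFrobDist
      linkNbrT fun e z => βW / 4 * (tInfluence e z : ℝ) := by
  have hmod : OneLinkKRModulus 2 (3 * βW / 2) (4 * (1 / 4)) :=
    QuarterModulusOneHalf.oneLinkKRModulusSU2_of_le_oneHalf h12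
  have hR : |βW / 2| / (2 : ℕ) * (2 * (((4 : ℕ) : ℝ) - 1)) ≤ 3 * βW / 2 := by
    rw [abs_of_nonneg (by linarith)]; push_cast; linarith
  have h := isKRContraction_torusWilson (d := 4) (N := 2) (L := L) (by norm_num) (by norm_num) hL
    (by norm_num) hR hmod
  have e : (fun e z : Edge 4 L => 4 * (1 / 4 : ℝ) * (|βW / 2| / (2 : ℕ)) * (tInfluence e z : ℝ)) =
      fun e z => βW / 4 * (tInfluence e z : ℝ) := by
    funext e z
    rw [abs_of_nonneg (by linarith)]
    push_cast
    ring
  rw [e] at h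
  exact h

/-- **Window contraction of an `SU(2)` Wilson torus kernel from the single-link quarter modulus
and a super-solution** (brick B3″). Torus `(ℤ/L)^4`, `L ≥ 2`, Wilson coupling `0 ≤ β_W ≤ 1/2`
(tree coupling `β_W/2`), `c = β_W/4`, `n = tInfluence`: for a finite link set `Λ`, `y ∉ Λ`,
`ω = η` off `y`, `d ≥ 0` with `1 ≤ d_y` and `Σ_{z ∈ linkNbrT x} c·n(x,z)·d_z ≤ d_x` (`x ∈ Λ`), and
`Λ`-restricted row sums `Σ_{z ∈ linkNbrT x, z ∈ Λ} c·n(x,z) ≤ c' < 1` (`x ∈ Λ`), every bounded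
measurable `f` depending on `Δ` with per-link Frobenius-Lipschitz vector `δ` obeys
`|∫ f dγ_Λ(·|ω) − ∫ f dγ_Λ(·|η)| ≤ ‖ω_y − η_y‖_F · Σ_{z ∈ Δ} d_z δ_z` — the tree's
`DobrushinMetric.abs_kernel_sub_le_of_superSolution` (Dobrushin 1970 Thm. 3; Föllmer 1988 Ch. I
(2.8), (2.10)) run on `su2_isKRContraction_torusWilson`. -/
theorem su2Kernel_window_contraction (hL : 1 < L) {βW : ℝ} (h0 : 0 ≤ βW) (h12 : βW ≤ 1 / 2)
    (Λ : Finset (Edge 4 L)) {y : Edge 4 L} (hy : y ∉ Λ)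
    {ω η : GaugeConfig 4 L (Matrix.specialUnitaryGroup (Fin 2) ℂ)} (hωη : ∀ z, z ≠ y → ω z = η z)
    {dv : Edge 4 L → ℝ} (hd0 : ∀ z, 0 ≤ dv z) (hdy : 1 ≤ dv y)
    (hsol : ∀ x ∈ Λ, ∑ z ∈ linkNbrT x, βW / 4 * (tInfluence x z : ℝ) * dv z ≤ dv x)
    {c : ℝ} (hc0 : 0 ≤ c) (hc1 : c < 1)
    (hrowW : ∀ x ∈ Λ, ∑ z ∈ linkNbrT x, (if z ∈ Λ then βW / 4 * (tInfluence x z : ℝ) else 0) ≤ c)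
    {f : GaugeConfig 4 L (Matrix.specialUnitaryGroup (Fin 2) ℂ) → ℝ} (hfm : Measurable f)
    {Δ : Finset (Edge 4 L)} (hfdep : DependsOn f (↑Δ : Set (Edge 4 L))) {M : ℝ}
    (hM : ∀ σ, |f σ| ≤ M) {δ : Edge 4 L → ℝ} (hδ : IsLipBound suFrobDist f δ) :
    |(∫ σ, f σ ∂(torusWeightSpec (d := 4) (L := L) (wilsonPlaqWeight 2 (βW / 2)) Λ ω)) -
        ∫ σ, f σ ∂(torusWeightSpec (d := 4) (L := L) (wilsonPlaqWeight 2 (βW / 2)) Λ η)| ≤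
      suFrobDist (ω y) (η y) * ∑ z ∈ Δ, dv z * δ z := by
  haveI : SecondCountableTopology (Matrix (Fin 2) (Fin 2) ℂ) :=
    inferInstanceAs (SecondCountableTopology (Fin 2 → Fin 2 → ℂ))
  haveI : SecondCountableTopology (Matrix.specialUnitaryGroup (Fin 2) ℂ) :=
    Topology.IsEmbedding.subtypeVal.secondCountableTopology
  have hγ := isSpecification_torusWeightSpec (d := 4) (L := L)
    (continuous_wilsonPlaqWeight (N := 2) (βW / 2)) (wilsonPlaqWeight_pos (N := 2) (βW / 2))
  have hKR := su2_isKRContraction_torusWilson (L := L) hL h0 h12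
  have hR : (0 : ℝ) ≤ 2 * Real.sqrt (2 : ℕ) := by positivity
  exact abs_kernel_sub_le_of_superSolution hγ hKR suFrobDist_nonneg suFrobDist_le hR Λ hy hωη hd0
    hdy hsol hc0 hc1 hrowW hfm hfdep hM hδ

end Summit.Ventures.YMGap.DSWindow

end
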